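import Summits.HodgeConjecture.HodgeConjecture.Theorems.VHCAbelianSchemesRoadDegreeConfinement
import Literature.AlgebraicGeometry.HodgeTheory.HodgeClassesIsogenyInvariance
import Literature.AlgebraicGeometry.ComplexMultiplication.EndomorphismFieldCorankOneWeilPlane
import Summits.HodgeConjecture.HodgeConjecture.Theorems.VHCAbelianSchemesRoadLefschetzSlackPin
import HarnessLib

/-!
# Road b02 (`VHCAbelianSchemesRoad`, D-0059) — EXCEPTIONAL CHARTS: where the exceptional regime has CONTENT (the regime-2
# hypothesis read on one fibre through a morphism; Weil planes of simple CM pairs)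

research route conditional on HC_CM; not a corollary; Q11.4-sentence-2 already refuted in dim ≥ 3.

THEOREMS ONLY (no definition, no named fact, no sorry; `HC_CM` occurs nowhere; nothing of the road's research content is claimed, no
pencil is constructed). Companion of the degree confinement (`VHCAbelianSchemesRoadDegreeConfinement.lean`, p442807): there regime 2
was shown VOID off `2 ≤ p ≤ n − 2`; here its hypothesis «`W` is NOT an algebraic Lefschetz class on every fibre» is given a
ONE-FIBRE SUFFICIENT CONDITION that the tree can check on its typed objects, so that the graded crux `LefAtExceptionalRegimeAt 𝒪 n p`
is seen to DEMAND a carrier (not be vacuous) on the pencils of record: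

* §1 `not_forall_algebraic_lefschetz_of_chart` — if some fibre `𝒳_{s₁}` receives a morphism `g : Y ⟶ 𝒳_{s₁}` from a smooth projective
  `Y` pulling `W|_{s₁}` back OUTSIDE the divisor ring `Dᵖ(Y) ⊗ ℂ`, then `W` is not algebraic-Lefschetz on every fibre (pull-back
  functoriality of the divisor ring, the tree's `map_mem_divisorClassesSpan`). Door-free, datum-free.
* §2 `exists_datum_of_lefAtExceptionalRegimeAt_of_chart` — hence regime 2 at `(n, p)` PRODUCES an `𝒪`-admissible datum with
  `κ_p = a·W| + Z|` on every such pencil (the graded crux read as an existence statement with a checkable trigger); the abelian-variety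
  chart form `…_of_abelianChart`.
* §3 THE WEIL TRIGGER: on a SIMPLE pair `(A, ι : F ↪ End⁰ A)` of Kubota corank `≤ 1` with its own Weil structure `u` (`u² = −d`,
  `IsWeilType A u n d`) a NON-ZERO class of the Weil plane `W(A, u) ⊗ ℂ ⊆ H²ⁿ` is OUTSIDE `Dⁿ(A) ⊗ ℂ` (the tree's THEOREM
  `divisorClassesSpan_inf_weilClassesOf_eq_bot'`, van Geemen Thm. 6.12 «`Bⁿ = Dⁿ ⊕ ⋀_K^{2n} H¹`»); so on every pencil one of whose
  fibres receives a morphism from such an `A` pulling `W|_{s₁}` back to a non-zero Weil class, regime 2 at `(m, n)` demands a carrier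
  (`exists_datum_of_lefAtExceptionalRegimeAt_of_weilChart`); fourfold form (`n = 2`, corank `≤ 1` automatic:
  `divisorClassesSpan_inf_weilClassesOf_eq_bot`) `…_of_weilChart_fourfold` — the FIRST PAIR `(4, 2)` of the middle range with its
  printed habitat (simple CM fourfolds of Weil type, Moonen–Zarhin 1995 Thm. 2.4 / Gordon 5.13).

* §4 (appended) WITH A PICARD-RANK-ONE FIBRE the demanded datum is PINNED: `exists_pinned_of_lefAtExceptionalRegimeAt` (graded form of the
  pin corollary of `VHCAbelianSchemesRoadLefschetzSlackPin.lean`, p437804) and `exists_pinned_of_lefAtExceptionalRegimeAt_of_chart` —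
  chart trigger + Picard-rank-one fibre ⟹ an `𝒪`-admissible datum with `κ_p = a·W| + c·Θᵖ|`, `a ≠ 0`: the road's design problem in closed form.

What this does NOT do: construct any pencil or chart (they are hypotheses); produce any carrier; say anything in print terms beyond
van Geemen 6.12 / 4.11. With the pin (`VHCAbelianSchemesRoadLefschetzSlackPin.lean`, p437804) the demanded datum on a pencil with a
Picard-rank-one fibre has `κ_p = a·W| + c·Θᵖ|` exactly.

References: [cite: vanGeemen1994HodgeAV, §2.4, Thm. 4.11 and Thm. 6.12] [cite: Gordon1999HodgeAVSurvey, 5.13 (ii) and 9.4]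
[cite: MoonenZarhin1995Duke, Thm. 2.4] [cite: Bloch1972Semiregularity, Remark (7.5)] [cite: HatcherAT2002, Prop. 3.10].
-/

noncomputable section

open CategoryTheory CategoryTheory.Limits AlgebraicGeometry Topology NumberField

namespace Summit.HodgeConjecture.HodgeConjecture.Ring2.SemiregularRepresentatives

-- the cell's namespace repeats the summit name (`Summit.HodgeConjecture.HodgeConjecture…`), as in every `Ring2*` file
set_option linter.dupNamespace false

open Literature.AlgebraicGeometry Literature.AlgebraicGeometry.Motives
open Literature.AlgebraicGeometry.HodgeTheory
open Literature.AlgebraicGeometry.ComplexMultiplication Literature.AlgebraicGeometry.ComplexMultiplication.EndFieldFullDegree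
open Literature.NumberTheory.ComplexMultiplication (cmTypeOfPair)
open Literature.AlgebraicGeometry.Pohlmann1968 (cmTypeRank)
open Literature.AlgebraicTopology.SingularHomology
open Literature.Barriers.HodgeConjecture (divisorClassesSpan)
open Summit.Ventures.HSemireg (ObjClass)

/-! ## §1 The regime-2 hypothesis read on one fibre through a morphism -/

section Chart

variable {n M p : ℕ} {𝒳 S : SchemeOver ℂ} {f : 𝒳 ⟶ S}

/-- **One exceptional chart breaks «algebraic-Lefschetz on every fibre».** If a fibre `𝒳_{s₁}` of a smooth projective family of relative
dimension `n` receives a morphism `g : Y ⟶ 𝒳_{s₁}` from a smooth projective `Y` (dimension `M`) such that `g^*(W|_{s₁}) ∉ Dᵖ(Y) ⊗ ℂ`, then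
`W` is not an algebraic Lefschetz class on every fibre — since `g^*(Dᵖ(𝒳_{s₁}) ⊗ ℂ) ⊆ Dᵖ(Y) ⊗ ℂ` (`map_mem_divisorClassesSpan`).
[cite: vanGeemen1994HodgeAV, §2.4] [cite: HatcherAT2002, Prop. 3.10] -/
theorem not_forall_algebraic_lefschetz_of_chart (hf : IsSmoothProjectiveFamily f n) {W : complexBetti 𝒳 (2 * p)}
    (s₁ : ComplexPoints S) {Y : SchemeOver ℂ} (hY : IsSmoothProjective M Y) (g : Y ⟶ fiberOver f s₁)
    (hW : complexBetti.map g (2 * p) (complexBetti.map (fiberι f s₁) (2 * p) W) ∉ divisorClassesSpan Y M p) :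
    ¬ ∀ s : ComplexPoints S,
      complexBetti.map (fiberι f s) (2 * p) W ∈ algebraicClasses (fiberOver f s) p ∧
        complexBetti.map (fiberι f s) (2 * p) W ∈ divisorClassesSpan (fiberOver f s) n p :=
  fun h => hW (map_mem_divisorClassesSpan hY (hf.isSmoothProjective s₁) g (h s₁).2)

/-- The same through a chart by an abelian variety `A` (`A.X` is smooth projective of dimension `dim A`).
[cite: vanGeemen1994HodgeAV, §2.4] -/
theorem not_forall_algebraic_lefschetz_of_abelianChart (hf : IsSmoothProjectiveFamily f n) {W : complexBetti 𝒳 (2 * p)}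
    (s₁ : ComplexPoints S) (A : AbelianVariety ℂ) (g : A.X ⟶ fiberOver f s₁)
    (hW : complexBetti.map g (2 * p) (complexBetti.map (fiberι f s₁) (2 * p) W) ∉ divisorClassesSpan A.X A.dim p) :
    ¬ ∀ s : ComplexPoints S,
      complexBetti.map (fiberι f s) (2 * p) W ∈ algebraicClasses (fiberOver f s) p ∧
        complexBetti.map (fiberι f s) (2 * p) W ∈ divisorClassesSpan (fiberOver f s) n p :=
  not_forall_algebraic_lefschetz_of_chart hf s₁ (AbelianVariety.isSmoothProjective_holds (A := A)) g hW

/-- Such a chart forces `(n, p)` into the MIDDLE RANGE `2 ≤ p ≤ n − 2` (degree confinement, contrapositive).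
[cite: MoonenZarhin1999LowDim, Introduction (p. 711)] [cite: vanGeemen1994HodgeAV, §2.4] -/
theorem midRange_of_chart (hf : IsSmoothProjectiveFamily f n) {W : complexBetti 𝒳 (2 * p)}
    (hW : ∀ s : ComplexPoints S, IsRationalClass (complexBetti.map (fiberι f s) (2 * p) W) ∧
      IsOfHodgeType n (fiberOver f s) (2 * p) p p (complexBetti.map (fiberι f s) (2 * p) W))
    (s₁ : ComplexPoints S) {Y : SchemeOver ℂ} (hY : IsSmoothProjective M Y) (g : Y ⟶ fiberOver f s₁)
    (hexc : complexBetti.map g (2 * p) (complexBetti.map (fiberι f s₁) (2 * p) W) ∉ divisorClassesSpan Y M p) :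
    2 ≤ p ∧ p + 2 ≤ n :=
  midRange_of_not_algebraic_lefschetz (hf.isSmoothProjective s₁) (hW s₁).1 (hW s₁).2 fun h =>
    hexc (map_mem_divisorClassesSpan hY (hf.isSmoothProjective s₁) g h.2)

end Chart

/-! ## §2 Regime 2 DEMANDS a datum on every pencil with an exceptional chart -/

section Datum

variable {𝒪 : ObjClass} {n M p : ℕ} {𝒳 S : SchemeOver ℂ} {f : 𝒳 ⟶ S}

/-- **Regime 2 at `(n, p)`, read as an existence statement with a checkable trigger.** On a one-parameter abelian scheme of the crux's
shape (relative dimension `n`, smooth irreducible affine base curve, section), for a fibrewise rational `(p,p)` global class `W` algebraic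
at `s₀`, ONE fibre `s₁` with a chart `g : Y ⟶ 𝒳_{s₁}` pulling `W|_{s₁}` outside `Dᵖ(Y) ⊗ ℂ` makes `LefAtExceptionalRegimeAt 𝒪 n p` PRODUCE
an `𝒪`-admissible datum `(s, I ∋ p, κ, V, a ≠ 0, Z)` with `κ_p = (a·W + Z)|_s`, `Z` fibrewise algebraic-Lefschetz.
[cite: Bloch1972Semiregularity, Remark (7.5)] [cite: vanGeemen1994HodgeAV, §2.4 and Thm. 4.11] -/
theorem exists_datum_of_lefAtExceptionalRegimeAt_of_chart (h : LefAtExceptionalRegimeAt 𝒪 n p)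
    (hf : IsSmoothProjectiveFamily f n) (h𝒳 : IsQuasiProjectiveOver 𝒳) (hirr : IrreducibleSpace S.left) (haff : IsAffine S.left)
    (hsm : AlgebraicGeometry.Smooth S.hom) (hdim : topologicalKrullDim S.left = 1)
    (habel : ∀ s : ComplexPoints S, ∃ A' : AbelianVariety ℂ, A'.dim = n ∧ Nonempty (A'.X ≅ fiberOver f s))
    (he : ∃ e : S ⟶ 𝒳, e ≫ f = 𝟙 S) (W : complexBetti 𝒳 (2 * p))
    (hW : ∀ s : ComplexPoints S, IsRationalClass (complexBetti.map (fiberι f s) (2 * p) W) ∧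
      IsOfHodgeType n (fiberOver f s) (2 * p) p p (complexBetti.map (fiberι f s) (2 * p) W))
    (s₀ : ComplexPoints S) (hs₀ : complexBetti.map (fiberι f s₀) (2 * p) W ∈ algebraicClasses (fiberOver f s₀) p)
    (s₁ : ComplexPoints S) {Y : SchemeOver ℂ} (hY : IsSmoothProjective M Y) (g : Y ⟶ fiberOver f s₁)
    (hexc : complexBetti.map g (2 * p) (complexBetti.map (fiberι f s₁) (2 * p) W) ∉ divisorClassesSpan Y M p) :
    ∃ (s : ComplexPoints S) (I : Finset ℕ) (κ : (q : ℕ) → complexBetti (fiberOver f s) (2 * q))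
      (V : (q : ℕ) → complexBetti 𝒳 (2 * q)) (a : ℂ) (Z : complexBetti 𝒳 (2 * p)),
      p ∈ I ∧ 𝒪 n (fiberOver f s) I κ ∧ a ≠ 0 ∧
      (∀ t : ComplexPoints S,
        complexBetti.map (fiberι f t) (2 * p) Z ∈ algebraicClasses (fiberOver f t) p ∧
        complexBetti.map (fiberι f t) (2 * p) Z ∈ divisorClassesSpan (fiberOver f t) n p) ∧
      V p = a • W + Z ∧
      (∀ q ∈ I, κ q = complexBetti.map (fiberι f s) (2 * q) (V q)) ∧
      (∀ q ∈ I, ∀ t : ComplexPoints S,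
        IsOfHodgeType n (fiberOver f t) (2 * q) q q (complexBetti.map (fiberι f t) (2 * q) (V q))) :=
  h f hf h𝒳 hirr haff hsm hdim habel he W hW s₀ hs₀ (not_forall_algebraic_lefschetz_of_chart hf s₁ hY g hexc)

/-- The same with the UNGRADED regime `LefAtExceptionalRegime 𝒪` (or, for null-data doors, with K-SR♭∃ itself through
`admissibleRepresentativesLefAt_iff_lefAtExceptionalRegime_of_hasNullDatum`). [cite: Bloch1972Semiregularity, Remark (7.5)] -/
theorem exists_datum_of_lefAtExceptionalRegime_of_chart (h : LefAtExceptionalRegime 𝒪)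
    (hf : IsSmoothProjectiveFamily f n) (h𝒳 : IsQuasiProjectiveOver 𝒳) (hirr : IrreducibleSpace S.left) (haff : IsAffine S.left)
    (hsm : AlgebraicGeometry.Smooth S.hom) (hdim : topologicalKrullDim S.left = 1)
    (habel : ∀ s : ComplexPoints S, ∃ A' : AbelianVariety ℂ, A'.dim = n ∧ Nonempty (A'.X ≅ fiberOver f s))
    (he : ∃ e : S ⟶ 𝒳, e ≫ f = 𝟙 S) (W : complexBetti 𝒳 (2 * p))
    (hW : ∀ s : ComplexPoints S, IsRationalClass (complexBetti.map (fiberι f s) (2 * p) W) ∧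
      IsOfHodgeType n (fiberOver f s) (2 * p) p p (complexBetti.map (fiberι f s) (2 * p) W))
    (s₀ : ComplexPoints S) (hs₀ : complexBetti.map (fiberι f s₀) (2 * p) W ∈ algebraicClasses (fiberOver f s₀) p)
    (s₁ : ComplexPoints S) {Y : SchemeOver ℂ} (hY : IsSmoothProjective M Y) (g : Y ⟶ fiberOver f s₁)
    (hexc : complexBetti.map g (2 * p) (complexBetti.map (fiberι f s₁) (2 * p) W) ∉ divisorClassesSpan Y M p) :
    ∃ (s : ComplexPoints S) (I : Finset ℕ) (κ : (q : ℕ) → complexBetti (fiberOver f s) (2 * q))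
      (V : (q : ℕ) → complexBetti 𝒳 (2 * q)) (a : ℂ) (Z : complexBetti 𝒳 (2 * p)),
      p ∈ I ∧ 𝒪 n (fiberOver f s) I κ ∧ a ≠ 0 ∧
      (∀ t : ComplexPoints S,
        complexBetti.map (fiberι f t) (2 * p) Z ∈ algebraicClasses (fiberOver f t) p ∧
        complexBetti.map (fiberι f t) (2 * p) Z ∈ divisorClassesSpan (fiberOver f t) n p) ∧
      V p = a • W + Z ∧
      (∀ q ∈ I, κ q = complexBetti.map (fiberι f s) (2 * q) (V q)) ∧
      (∀ q ∈ I, ∀ t : ComplexPoints S,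
        IsOfHodgeType n (fiberOver f t) (2 * q) q q (complexBetti.map (fiberι f t) (2 * q) (V q))) :=
  exists_datum_of_lefAtExceptionalRegimeAt_of_chart (lefAtExceptionalRegime_iff_forall_at.1 h n p) hf h𝒳 hirr haff hsm hdim
    habel he W hW s₀ hs₀ s₁ hY g hexc

end Datum

/-! ## §3 The Weil trigger: Weil planes of simple CM pairs lie outside the divisor ring -/

section Weil

variable {F : Type} [Field F] [NumberField F] [IsCMField F] {A : AbelianVariety ℂ}
  (ιF : F →+* A.endAlgebra) (hF : Module.finrank ℚ F = 2 * A.dim) {α : F} {u : End A} {k d : ℕ}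

include ιF hF in
/-- **A non-zero class of the Weil plane of a simple CM pair of corank `≤ 1` is NOT a divisor polynomial** — `Dᵏ(A) ⊗ ℂ ∩ W(A, u) ⊗ ℂ = 0`
(the tree's THEOREM `divisorClassesSpan_inf_weilClassesOf_eq_bot'`, van Geemen Thm. 6.12 «`Bⁿ(X) = Dⁿ ⊕ ⋀_K^{2n} H¹(X, ℚ)`»; `dim A = 2k`).
[cite: vanGeemen1994HodgeAV, Thm. 6.12 and 4.11] [cite: Gordon1999HodgeAVSurvey, 9.4 and 5.13 (ii)] -/
theorem not_mem_divisorClassesSpan_of_mem_weilClassesOf (hS : AbelianVariety.IsSimple A)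
    (hrank : A.dim ≤ cmTypeRank (cmTypeOfPair ιF hF)) (hu : AbelianVariety.endAlgebra.of A u = ιF α)
    (h : HodgeTheory.IsWeilType A u k d) {c : complexBetti A.X (2 * k)} (hc : c ∈ weilClassesOf A u k d) (hc0 : c ≠ 0) :
    c ∉ divisorClassesSpan A.X A.dim k := by
  intro hcD
  have hbot := divisorClassesSpan_inf_weilClassesOf_eq_bot' ιF hF hS hrank hu h
  have hmem : c ∈ divisorClassesSpan A.X A.dim k ⊓ weilClassesOf A u k d := ⟨hcD, hc⟩
  rw [hbot, Submodule.mem_bot] at hmem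
  exact hc0 hmem

include ιF hF in
/-- Fourfold form (`k = 2`): for a SIMPLE CM pair of Weil type in dimension `4` corank `≤ 1` is automatic
(`divisorClassesSpan_inf_weilClassesOf_eq_bot`, Gordon 5.13 (ii) «`8 = 6 + 2`»; Moonen–Zarhin 1995 Thm. 2.4).
[cite: Gordon1999HodgeAVSurvey, 5.13 (ii)] [cite: MoonenZarhin1995Duke, Thm. 2.4] [cite: vanGeemen1994HodgeAV, Thm. 6.12] -/
theorem not_mem_divisorClassesSpan_of_mem_weilClassesOf_fourfold (hS : AbelianVariety.IsSimple A)
    (hu : AbelianVariety.endAlgebra.of A u = ιF α) (h : HodgeTheory.IsWeilType A u 2 d)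
    {c : complexBetti A.X (2 * 2)} (hc : c ∈ weilClassesOf A u 2 d) (hc0 : c ≠ 0) :
    c ∉ divisorClassesSpan A.X A.dim 2 := by
  intro hcD
  have hbot := divisorClassesSpan_inf_weilClassesOf_eq_bot ιF hF hS hu h
  have hmem : c ∈ divisorClassesSpan A.X A.dim 2 ⊓ weilClassesOf A u 2 d := ⟨hcD, hc⟩
  rw [hbot, Submodule.mem_bot] at hmem
  exact hc0 hmem

variable {𝒪 : ObjClass} {m : ℕ} {𝒳 S : SchemeOver ℂ} {f : 𝒳 ⟶ S}

include ιF hF in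
/-- **Regime 2 at `(m, k)` DEMANDS a carrier on every pencil with a Weil chart.** On a one-parameter abelian scheme of the crux's shape
(relative dimension `m`), for a fibrewise rational `(k,k)` global class `W` algebraic at `s₀`, if ONE fibre `𝒳_{s₁}` receives a morphism
`g : A.X ⟶ 𝒳_{s₁}` from a SIMPLE CM pair `(A, ι)` of corank `≤ 1` with Weil structure `u` (`IsWeilType A u k d`, `dim A = 2k`) pulling
`W|_{s₁}` back to a NON-ZERO class of the Weil plane `W(A, u) ⊗ ℂ`, then `LefAtExceptionalRegimeAt 𝒪 m k` produces an `𝒪`-admissible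
datum with `κ_k = (a·W + Z)|`, `a ≠ 0`, `Z` fibrewise algebraic-Lefschetz — the graded crux is NOT vacuous there. (Typical use: `m = 2k`,
`g` a chart `A.X ≅ 𝒳_{s₁}` at a CM fibre of Weil type of a Mumford–Tate pencil; no pencil is constructed here.)
[cite: vanGeemen1994HodgeAV, Thm. 6.12, 4.11 and §2.4] [cite: Bloch1972Semiregularity, Remark (7.5)] -/
theorem exists_datum_of_lefAtExceptionalRegimeAt_of_weilChart (h : LefAtExceptionalRegimeAt 𝒪 m k)
    (hf : IsSmoothProjectiveFamily f m) (h𝒳 : IsQuasiProjectiveOver 𝒳) (hirr : IrreducibleSpace S.left) (haff : IsAffine S.left)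
    (hsm : AlgebraicGeometry.Smooth S.hom) (hdim : topologicalKrullDim S.left = 1)
    (habel : ∀ s : ComplexPoints S, ∃ A' : AbelianVariety ℂ, A'.dim = m ∧ Nonempty (A'.X ≅ fiberOver f s))
    (he : ∃ e : S ⟶ 𝒳, e ≫ f = 𝟙 S) (W : complexBetti 𝒳 (2 * k))
    (hW : ∀ s : ComplexPoints S, IsRationalClass (complexBetti.map (fiberι f s) (2 * k) W) ∧
      IsOfHodgeType m (fiberOver f s) (2 * k) k k (complexBetti.map (fiberι f s) (2 * k) W))
    (s₀ : ComplexPoints S) (hs₀ : complexBetti.map (fiberι f s₀) (2 * k) W ∈ algebraicClasses (fiberOver f s₀) k)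
    (s₁ : ComplexPoints S) (hS : AbelianVariety.IsSimple A) (hrank : A.dim ≤ cmTypeRank (cmTypeOfPair ιF hF))
    (hu : AbelianVariety.endAlgebra.of A u = ιF α) (hWeil : HodgeTheory.IsWeilType A u k d) (g : A.X ⟶ fiberOver f s₁)
    (hc : complexBetti.map g (2 * k) (complexBetti.map (fiberι f s₁) (2 * k) W) ∈ weilClassesOf A u k d)
    (hc0 : complexBetti.map g (2 * k) (complexBetti.map (fiberι f s₁) (2 * k) W) ≠ 0) :
    ∃ (s : ComplexPoints S) (I : Finset ℕ) (κ : (q : ℕ) → complexBetti (fiberOver f s) (2 * q))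
      (V : (q : ℕ) → complexBetti 𝒳 (2 * q)) (a : ℂ) (Z : complexBetti 𝒳 (2 * k)),
      k ∈ I ∧ 𝒪 m (fiberOver f s) I κ ∧ a ≠ 0 ∧
      (∀ t : ComplexPoints S,
        complexBetti.map (fiberι f t) (2 * k) Z ∈ algebraicClasses (fiberOver f t) k ∧
        complexBetti.map (fiberι f t) (2 * k) Z ∈ divisorClassesSpan (fiberOver f t) m k) ∧
      V k = a • W + Z ∧
      (∀ q ∈ I, κ q = complexBetti.map (fiberι f s) (2 * q) (V q)) ∧
      (∀ q ∈ I, ∀ t : ComplexPoints S,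
        IsOfHodgeType m (fiberOver f t) (2 * q) q q (complexBetti.map (fiberι f t) (2 * q) (V q))) :=
  exists_datum_of_lefAtExceptionalRegimeAt_of_chart h hf h𝒳 hirr haff hsm hdim habel he W hW s₀ hs₀ s₁
    (AbelianVariety.isSmoothProjective_holds (A := A)) g
    (not_mem_divisorClassesSpan_of_mem_weilClassesOf ιF hF hS hrank hu hWeil hc hc0)

include ιF hF in
/-- **The first pair `(4, 2)` with its printed habitat**: on a pencil with a chart from a SIMPLE CM FOURFOLD pair of Weil type pulling
`W|_{s₁}` back to a non-zero Weil class, regime 2 at `(m, 2)` demands a carrier; and such a chart forces `m ≥ 4`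
(`midRange_of_chart`). [cite: MoonenZarhin1995Duke, Thm. 2.4] [cite: Gordon1999HodgeAVSurvey, 5.13 (ii)] [cite: vanGeemen1994HodgeAV, Thm. 4.11] -/
theorem exists_datum_of_lefAtExceptionalRegimeAt_of_weilChart_fourfold (h : LefAtExceptionalRegimeAt 𝒪 m 2)
    (hf : IsSmoothProjectiveFamily f m) (h𝒳 : IsQuasiProjectiveOver 𝒳) (hirr : IrreducibleSpace S.left) (haff : IsAffine S.left)
    (hsm : AlgebraicGeometry.Smooth S.hom) (hdim : topologicalKrullDim S.left = 1)
    (habel : ∀ s : ComplexPoints S, ∃ A' : AbelianVariety ℂ, A'.dim = m ∧ Nonempty (A'.X ≅ fiberOver f s))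
    (he : ∃ e : S ⟶ 𝒳, e ≫ f = 𝟙 S) (W : complexBetti 𝒳 (2 * 2))
    (hW : ∀ s : ComplexPoints S, IsRationalClass (complexBetti.map (fiberι f s) (2 * 2) W) ∧
      IsOfHodgeType m (fiberOver f s) (2 * 2) 2 2 (complexBetti.map (fiberι f s) (2 * 2) W))
    (s₀ : ComplexPoints S) (hs₀ : complexBetti.map (fiberι f s₀) (2 * 2) W ∈ algebraicClasses (fiberOver f s₀) 2)
    (s₁ : ComplexPoints S) (hS : AbelianVariety.IsSimple A) (hu : AbelianVariety.endAlgebra.of A u = ιF α)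
    (hWeil : HodgeTheory.IsWeilType A u 2 d) (g : A.X ⟶ fiberOver f s₁)
    (hc : complexBetti.map g (2 * 2) (complexBetti.map (fiberι f s₁) (2 * 2) W) ∈ weilClassesOf A u 2 d)
    (hc0 : complexBetti.map g (2 * 2) (complexBetti.map (fiberι f s₁) (2 * 2) W) ≠ 0) :
    ∃ (s : ComplexPoints S) (I : Finset ℕ) (κ : (q : ℕ) → complexBetti (fiberOver f s) (2 * q))
      (V : (q : ℕ) → complexBetti 𝒳 (2 * q)) (a : ℂ) (Z : complexBetti 𝒳 (2 * 2)),
      2 ∈ I ∧ 𝒪 m (fiberOver f s) I κ ∧ a ≠ 0 ∧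
      (∀ t : ComplexPoints S,
        complexBetti.map (fiberι f t) (2 * 2) Z ∈ algebraicClasses (fiberOver f t) 2 ∧
        complexBetti.map (fiberι f t) (2 * 2) Z ∈ divisorClassesSpan (fiberOver f t) m 2) ∧
      V 2 = a • W + Z ∧
      (∀ q ∈ I, κ q = complexBetti.map (fiberι f s) (2 * q) (V q)) ∧
      (∀ q ∈ I, ∀ t : ComplexPoints S,
        IsOfHodgeType m (fiberOver f t) (2 * q) q q (complexBetti.map (fiberι f t) (2 * q) (V q))) :=
  exists_datum_of_lefAtExceptionalRegimeAt_of_chart h hf h𝒳 hirr haff hsm hdim habel he W hW s₀ hs₀ s₁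
    (AbelianVariety.isSmoothProjective_holds (A := A)) g
    (not_mem_divisorClassesSpan_of_mem_weilClassesOf_fourfold ιF hF hS hu hWeil hc hc0)

include ιF hF in
/-- A Weil chart as above forces the pencil's pair `(m, k)` into the middle range: `2 ≤ k` and `k + 2 ≤ m` (so `m ≥ 4`; with a chart
ISOMORPHISM, `m = 2k`). [cite: MoonenZarhin1999LowDim, Introduction (p. 711)] [cite: vanGeemen1994HodgeAV, Thm. 6.12] -/
theorem midRange_of_weilChart (hf : IsSmoothProjectiveFamily f m) {W : complexBetti 𝒳 (2 * k)}
    (hW : ∀ s : ComplexPoints S, IsRationalClass (complexBetti.map (fiberι f s) (2 * k) W) ∧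
      IsOfHodgeType m (fiberOver f s) (2 * k) k k (complexBetti.map (fiberι f s) (2 * k) W))
    (s₁ : ComplexPoints S) (hS : AbelianVariety.IsSimple A) (hrank : A.dim ≤ cmTypeRank (cmTypeOfPair ιF hF))
    (hu : AbelianVariety.endAlgebra.of A u = ιF α) (hWeil : HodgeTheory.IsWeilType A u k d) (g : A.X ⟶ fiberOver f s₁)
    (hc : complexBetti.map g (2 * k) (complexBetti.map (fiberι f s₁) (2 * k) W) ∈ weilClassesOf A u k d)
    (hc0 : complexBetti.map g (2 * k) (complexBetti.map (fiberι f s₁) (2 * k) W) ≠ 0) : 2 ≤ k ∧ k + 2 ≤ m :=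
  midRange_of_chart hf hW s₁ (AbelianVariety.isSmoothProjective_holds (A := A)) g
    (not_mem_divisorClassesSpan_of_mem_weilClassesOf ιF hF hS hrank hu hWeil hc hc0)

end Weil

/-! ## §4 With a Picard-rank-one fibre: the demanded datum is PINNED (`κ_p = a·W| + c·Θᵖ|`) -/

section Pinned

variable {𝒪 : ObjClass} {n M p : ℕ} {𝒳 S : SchemeOver ℂ} {f : 𝒳 ⟶ S}

/-- **Graded pin**: regime 2 at `(n, p)` on a pencil with a Picard-rank-one fibre `s₀` (every rational `(1,1)`-class of `𝒳_{s₀}` on the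
line `ℂ·Θ|_{s₀}`, `Θ` a global degree-2 class) delivers, whenever its hypothesis is met, a datum with `κ_p = a·W|_{s₁} + c·(Θᵖ)|_{s₁}` and
`V_p ≡ a·W + c·Θᵖ` on every fibre (the graded form of `exists_pinned_of_lefAtExceptionalRegime`, p437804, via `pinned_of_lefAtDatum`).
[cite: Bloch1972Semiregularity, Remark (7.5)] [cite: vanGeemen1994HodgeAV, Thm. 4.11 and §2.4] [cite: DeligneHodgeII1971, Cor. 4.1.2 (proof)] -/
theorem exists_pinned_of_lefAtExceptionalRegimeAt (h : LefAtExceptionalRegimeAt 𝒪 n p)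
    (hf : IsSmoothProjectiveFamily f n) (h𝒳 : IsQuasiProjectiveOver 𝒳) (hirr : IrreducibleSpace S.left) (haff : IsAffine S.left)
    (hsm : AlgebraicGeometry.Smooth S.hom) (hdim : topologicalKrullDim S.left = 1)
    (habel : ∀ s : ComplexPoints S, ∃ A' : AbelianVariety ℂ, A'.dim = n ∧ Nonempty (A'.X ≅ fiberOver f s))
    (he : ∃ e : S ⟶ 𝒳, e ≫ f = 𝟙 S) (W : complexBetti 𝒳 (2 * p))
    (hW : ∀ s : ComplexPoints S, IsRationalClass (complexBetti.map (fiberι f s) (2 * p) W) ∧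
      IsOfHodgeType n (fiberOver f s) (2 * p) p p (complexBetti.map (fiberι f s) (2 * p) W))
    (s' : ComplexPoints S) (hs' : complexBetti.map (fiberι f s') (2 * p) W ∈ algebraicClasses (fiberOver f s') p)
    (hexc : ¬ ∀ s : ComplexPoints S,
      complexBetti.map (fiberι f s) (2 * p) W ∈ algebraicClasses (fiberOver f s) p ∧
      complexBetti.map (fiberι f s) (2 * p) W ∈ divisorClassesSpan (fiberOver f s) n p)
    (Θ : complexBetti 𝒳 2) {s₀ : ComplexPoints S}
    (hpic : ∀ b : complexBetti (fiberOver f s₀) 2, IsRationalClass b → IsOfHodgeType n (fiberOver f s₀) 2 1 1 b →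
      b ∈ ℂ ∙ complexBetti.map (fiberι f s₀) 2 Θ) :
    ∃ (s₁ : ComplexPoints S) (I : Finset ℕ) (κ : (q : ℕ) → complexBetti (fiberOver f s₁) (2 * q))
      (V : (q : ℕ) → complexBetti 𝒳 (2 * q)) (a c : ℂ),
      p ∈ I ∧ 𝒪 n (fiberOver f s₁) I κ ∧ a ≠ 0 ∧
      κ p = a • complexBetti.map (fiberι f s₁) (2 * p) W + c • complexBetti.map (fiberι f s₁) (2 * p) (cupPowTwo Θ p) ∧
      (∀ s : ComplexPoints S, complexBetti.map (fiberι f s) (2 * p) (V p) =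
        a • complexBetti.map (fiberι f s) (2 * p) W + c • complexBetti.map (fiberι f s) (2 * p) (cupPowTwo Θ p)) ∧
      (∀ q ∈ I, κ q = complexBetti.map (fiberι f s₁) (2 * q) (V q)) ∧
      (∀ q ∈ I, ∀ s : ComplexPoints S, IsOfHodgeType n (fiberOver f s) (2 * q) q q (complexBetti.map (fiberι f s) (2 * q) (V q))) := by
  obtain ⟨s₁, I, κ, V, a, Z, hpI, hκ, ha, hZ, hVp, hκV, hVH⟩ := h f hf h𝒳 hirr haff hsm hdim habel he W hW s' hs' hexc
  obtain ⟨c, hV, hκp⟩ := pinned_of_lefAtDatum hf hirr hsm Θ hpic W Z (V p) a (κ p) hVp (hκV p hpI) fun s ↦ (hZ s).2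
  exact ⟨s₁, I, κ, V, a, c, hpI, hκ, ha, hκp, hV, hκV, hVH⟩

/-- **Chart trigger + Picard-rank-one fibre ⟹ a PINNED carrier is demanded**: on a pencil of the crux's shape with a fibre `𝒳_{s₁}`
receiving `g : Y ⟶ 𝒳_{s₁}` (`Y` smooth projective) with `g^*(W|_{s₁}) ∉ Dᵖ(Y) ⊗ ℂ` and a Picard-rank-one fibre `s₀`, regime 2 at `(n, p)`
produces an `𝒪`-admissible datum at some fibre `s` with `κ_p = a·W|_s + c·(Θᵖ)|_s`, `a ≠ 0` — THE DESIGN PROBLEM of the road in closed form.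
[cite: Bloch1972Semiregularity, Remark (7.5)] [cite: vanGeemen1994HodgeAV, Thm. 4.11 and §2.4] -/
theorem exists_pinned_of_lefAtExceptionalRegimeAt_of_chart (h : LefAtExceptionalRegimeAt 𝒪 n p)
    (hf : IsSmoothProjectiveFamily f n) (h𝒳 : IsQuasiProjectiveOver 𝒳) (hirr : IrreducibleSpace S.left) (haff : IsAffine S.left)
    (hsm : AlgebraicGeometry.Smooth S.hom) (hdim : topologicalKrullDim S.left = 1)
    (habel : ∀ s : ComplexPoints S, ∃ A' : AbelianVariety ℂ, A'.dim = n ∧ Nonempty (A'.X ≅ fiberOver f s))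
    (he : ∃ e : S ⟶ 𝒳, e ≫ f = 𝟙 S) (W : complexBetti 𝒳 (2 * p))
    (hW : ∀ s : ComplexPoints S, IsRationalClass (complexBetti.map (fiberι f s) (2 * p) W) ∧
      IsOfHodgeType n (fiberOver f s) (2 * p) p p (complexBetti.map (fiberι f s) (2 * p) W))
    (s' : ComplexPoints S) (hs' : complexBetti.map (fiberι f s') (2 * p) W ∈ algebraicClasses (fiberOver f s') p)
    (s₁ : ComplexPoints S) {Y : SchemeOver ℂ} (hY : IsSmoothProjective M Y) (g : Y ⟶ fiberOver f s₁)
    (hexc : complexBetti.map g (2 * p) (complexBetti.map (fiberι f s₁) (2 * p) W) ∉ divisorClassesSpan Y M p)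
    (Θ : complexBetti 𝒳 2) {s₀ : ComplexPoints S}
    (hpic : ∀ b : complexBetti (fiberOver f s₀) 2, IsRationalClass b → IsOfHodgeType n (fiberOver f s₀) 2 1 1 b →
      b ∈ ℂ ∙ complexBetti.map (fiberι f s₀) 2 Θ) :
    ∃ (s : ComplexPoints S) (I : Finset ℕ) (κ : (q : ℕ) → complexBetti (fiberOver f s) (2 * q))
      (V : (q : ℕ) → complexBetti 𝒳 (2 * q)) (a c : ℂ),
      p ∈ I ∧ 𝒪 n (fiberOver f s) I κ ∧ a ≠ 0 ∧
      κ p = a • complexBetti.map (fiberι f s) (2 * p) W + c • complexBetti.map (fiberι f s) (2 * p) (cupPowTwo Θ p) ∧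
      (∀ t : ComplexPoints S, complexBetti.map (fiberι f t) (2 * p) (V p) =
        a • complexBetti.map (fiberι f t) (2 * p) W + c • complexBetti.map (fiberι f t) (2 * p) (cupPowTwo Θ p)) ∧
      (∀ q ∈ I, κ q = complexBetti.map (fiberι f s) (2 * q) (V q)) ∧
      (∀ q ∈ I, ∀ t : ComplexPoints S, IsOfHodgeType n (fiberOver f t) (2 * q) q q (complexBetti.map (fiberι f t) (2 * q) (V q))) :=
  exists_pinned_of_lefAtExceptionalRegimeAt h hf h𝒳 hirr haff hsm hdim habel he W hW s' hs'
    (not_forall_algebraic_lefschetz_of_chart hf s₁ hY g hexc) Θ hpic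

end Pinned

end Summit.HodgeConjecture.HodgeConjecture.Ring2.SemiregularRepresentatives

end
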